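import Summits.QuantumFields.YangMills.Theorems.HyperbolicRegulatorCurvatureAnchorRDefs

/-!
# Stub `stub_kunneth` of line `witten_hessian` (crux `CurvatureAnchorR`, stmt-QuantumFields-18155), part 1: the factor complex

Cochain calculus of ONE finite square complex `S = (V, E, Q)` (`σ, τ` the endpoints of an edge,
`bd q : Fin 4 → ℕ × Bool` the boundary word of a square, flag = direction) on real cochains
`ℕ → ℝ` (values off `V`/`E`/`Q` are never read).  No new definitions are introduced: the four
operators are always written out,

* gradient `d₀ f (e) = f (τ e) − f (σ e)`,
* divergence `d₀* u (x) = (∑_{e ∈ E, τ e = x} u e) − (∑_{e ∈ E, σ e = x} u e)` (one half of the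
  product divergence `dv` of `KunnethGap`),
* curl `d₁ u (q) = ∑_{i : Fin 4} (±1) · u (bd q i).1` (the pattern of `dA`/`dB` of `KunnethGap`),
* co-curl `d₁† g (e) = ∑_{q ∈ Q} ∑_i [ (bd q i).1 = e ] (± g q)` (verbatim the inner sum of
  `DualPoinc`),

and the file proves: the two adjunctions `sum_mul_dv0` (`⟨f, d₀* u⟩_V = ⟨u, d₀ f⟩_E`) and
`sum_mul_curl` (`⟨g, d₁ u⟩_Q = ⟨u, d₁† g⟩_E`); the complex property `curl_grad` (`d₁ d₀ = 0`,
telescoping around a square); `cocurl_const` (`d₁† 1 = 0` on `E`: every edge lies in exactly two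
squares, at most once in each (`idx_unique`), with opposite flags by `Coh`); `cocurl_sub`;
the averaging identities `dv0_avg`, `curl_avg` (linearity of `d₀*`, `d₁` over a vertex-slot
average); and the mean/variance facts `sum_sq_sub_eq`, `card_mul_sq_div_le`, `sum_sub_mean`.
All of it is finite `Finset.sum` bookkeeping.  Consumed by
`HyperbolicRegulatorCurvatureAnchorRStubKunnethHodge.lean` (the Hodge gap of the factor) and
`HyperbolicRegulatorCurvatureAnchorRStubKunneth.lean` (the product step and the registered stub).
-/

set_option autoImplicit false

namespace Summit.QuantumFields.YangMills.Cruxes.CurvatureAnchorR.WittenHessian.Kunneth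

open scoped BigOperators Classical

/-! ## `SqCx` destructured -/

/-- `SqCx` with its two `let`s (`st`, `en`) substituted (definitional unfolding only). -/
theorem sqCx_elim {V E Q : Finset ℕ} {σ τ : ℕ → ℕ} {bd : ℕ → Fin 4 → ℕ × Bool}
    (h : SqCx V E Q σ τ bd) :
    (∀ e ∈ E, σ e ∈ V ∧ τ e ∈ V ∧ σ e ≠ τ e) ∧
      (∀ q ∈ Q, (∀ i, (bd q i).1 ∈ E) ∧
        (∀ i, (if (bd q i).2 then τ (bd q i).1 else σ (bd q i).1) =
          (if (bd q (i + 1)).2 then σ (bd q (i + 1)).1 else τ (bd q (i + 1)).1)) ∧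
        (fun i => if (bd q i).2 then σ (bd q i).1 else τ (bd q i).1).Injective) ∧
      (∀ e ∈ E, (Q.filter fun q => ∃ i, (bd q i).1 = e).card = 2) :=
  h

/-! ## Adjunctions and the complex property -/

/-- `⟨f, d₀* u⟩_V = ⟨u, d₀ f⟩_E` (needs only: endpoints of edges lie in `V`). -/
theorem sum_mul_dv0 {V E : Finset ℕ} {σ τ : ℕ → ℕ} (hE : ∀ e ∈ E, σ e ∈ V ∧ τ e ∈ V)
    (f u : ℕ → ℝ) :
    ∑ x ∈ V, f x * ((∑ e ∈ E.filter (fun e => τ e = x), u e) -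
        (∑ e ∈ E.filter (fun e => σ e = x), u e)) =
      ∑ e ∈ E, u e * (f (τ e) - f (σ e)) := by
  have key : ∀ ρ : ℕ → ℕ, (∀ e ∈ E, ρ e ∈ V) →
      ∑ x ∈ V, f x * ∑ e ∈ E.filter (fun e => ρ e = x), u e = ∑ e ∈ E, f (ρ e) * u e := by
    intro ρ hρ
    calc ∑ x ∈ V, f x * ∑ e ∈ E.filter (fun e => ρ e = x), u e
          = ∑ x ∈ V, ∑ e ∈ E.filter (fun e => ρ e = x), f (ρ e) * u e := by
            refine Finset.sum_congr rfl fun x _ => ?_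
            rw [Finset.mul_sum]
            refine Finset.sum_congr rfl fun e he => ?_
            rw [(Finset.mem_filter.1 he).2]
      _ = ∑ e ∈ E, f (ρ e) * u e := Finset.sum_fiberwise_of_maps_to hρ _
  simp only [mul_sub, Finset.sum_sub_distrib, key τ fun e he => (hE e he).2,
    key σ fun e he => (hE e he).1]
  rw [← Finset.sum_sub_distrib, ← Finset.sum_sub_distrib]
  exact Finset.sum_congr rfl fun e _ => by ring

/-- `⟨g, d₁ u⟩_Q = ⟨u, d₁† g⟩_E` (needs only: boundary edges of squares lie in `E`). -/
theorem sum_mul_curl {E Q : Finset ℕ} {bd : ℕ → Fin 4 → ℕ × Bool}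
    (hQ : ∀ q ∈ Q, ∀ i, (bd q i).1 ∈ E) (g u : ℕ → ℝ) :
    ∑ q ∈ Q, g q * ∑ i : Fin 4, (if (bd q i).2 then (1 : ℝ) else -1) * u (bd q i).1 =
      ∑ e ∈ E, u e * ∑ q ∈ Q, ∑ i : Fin 4,
        (if (bd q i).1 = e then (if (bd q i).2 then g q else -g q) else 0) := by
  have hrw : ∀ q ∈ Q, g q * ∑ i : Fin 4, (if (bd q i).2 then (1 : ℝ) else -1) * u (bd q i).1 =
      ∑ e ∈ E, ∑ i : Fin 4,
        u e * (if (bd q i).1 = e then (if (bd q i).2 then g q else -g q) else 0) := by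
    intro q hq
    rw [Finset.sum_comm, Finset.mul_sum]
    refine Finset.sum_congr rfl fun i _ => ?_
    have hrw' : ∀ e : ℕ,
        u e * (if (bd q i).1 = e then (if (bd q i).2 then g q else -g q) else 0) =
          if (bd q i).1 = e then u e * (if (bd q i).2 then g q else -g q) else 0 := by
      intro e
      split_ifs <;> simp
    simp only [hrw', Finset.sum_ite_eq, if_pos (hQ q hq i)]
    split_ifs <;> ring
  rw [Finset.sum_congr rfl hrw, Finset.sum_comm]
  refine Finset.sum_congr rfl fun e _ => ?_
  simp only [Finset.mul_sum]

/-- `d₁ (d₀ f) = 0` on a square whose boundary word closes up (clause 2b of `SqCx`). -/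
theorem curl_grad {σ τ : ℕ → ℕ} {bd : ℕ → Fin 4 → ℕ × Bool} {q : ℕ}
    (hq : ∀ i, (if (bd q i).2 then τ (bd q i).1 else σ (bd q i).1) =
      (if (bd q (i + 1)).2 then σ (bd q (i + 1)).1 else τ (bd q (i + 1)).1)) (f : ℕ → ℝ) :
    ∑ i : Fin 4, (if (bd q i).2 then (1 : ℝ) else -1) * (f (τ (bd q i).1) - f (σ (bd q i).1)) = 0 := by
  have key : ∀ i, (if (bd q i).2 then (1 : ℝ) else -1) * (f (τ (bd q i).1) - f (σ (bd q i).1)) =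
      f (if (bd q (i + 1)).2 then σ (bd q (i + 1)).1 else τ (bd q (i + 1)).1) -
        f (if (bd q i).2 then σ (bd q i).1 else τ (bd q i).1) := by
    intro i
    rw [← hq i]
    split_ifs <;> ring
  simp only [key, Finset.sum_sub_distrib]
  rw [sub_eq_zero]
  exact Fintype.sum_equiv (Equiv.addRight 1) _ _ fun i => rfl

/-- In `Fin 4`, `i + 2 ≠ i`. -/
theorem fin4_add_two_ne (i : Fin 4) : i + 1 + 1 ≠ i := by
  revert i
  decide

/-- Within one well-formed square an edge occurs at most once in the boundary word. -/
theorem idx_unique {σ τ : ℕ → ℕ} {bd : ℕ → Fin 4 → ℕ × Bool} {q : ℕ}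
    (hcyc : ∀ i, (if (bd q i).2 then τ (bd q i).1 else σ (bd q i).1) =
      (if (bd q (i + 1)).2 then σ (bd q (i + 1)).1 else τ (bd q (i + 1)).1))
    (hinj : (fun i => if (bd q i).2 then σ (bd q i).1 else τ (bd q i).1).Injective)
    {i i' : Fin 4} (h : (bd q i).1 = (bd q i').1) : i = i' := by
  by_cases hb : (bd q i).2 = (bd q i').2
  · apply hinj
    show (if (bd q i).2 then σ (bd q i).1 else τ (bd q i).1) =
      (if (bd q i').2 then σ (bd q i').1 else τ (bd q i').1)
    rw [h, hb]
  · have e1 : (if (bd q i).2 then τ (bd q i).1 else σ (bd q i).1) =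
        (if (bd q i').2 then σ (bd q i').1 else τ (bd q i').1) := by
      rw [h]
      cases h1 : (bd q i).2 <;> cases h2 : (bd q i').2 <;> simp_all
    have e2 : (if (bd q i').2 then τ (bd q i').1 else σ (bd q i').1) =
        (if (bd q i).2 then σ (bd q i).1 else τ (bd q i).1) := by
      rw [h]
      cases h1 : (bd q i).2 <;> cases h2 : (bd q i').2 <;> simp_all
    have i1 : i + 1 = i' :=
      hinj (show (if (bd q (i + 1)).2 then σ (bd q (i + 1)).1 else τ (bd q (i + 1)).1) =
        (if (bd q i').2 then σ (bd q i').1 else τ (bd q i').1) by rw [← hcyc i, e1])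
    have i2 : i' + 1 = i :=
      hinj (show (if (bd q (i' + 1)).2 then σ (bd q (i' + 1)).1 else τ (bd q (i' + 1)).1) =
        (if (bd q i).2 then σ (bd q i).1 else τ (bd q i).1) by rw [← hcyc i', e2])
    rw [← i1] at i2
    exact absurd i2 (fin4_add_two_ne i)

/-- `d₁† c = 0` on `E` for a constant `c`: every edge lies in exactly two squares (clause 3 of
`SqCx`), at most once in each (clause 2), with opposite flags (`Coh`). -/
theorem cocurl_const {E Q : Finset ℕ} {σ τ : ℕ → ℕ} {bd : ℕ → Fin 4 → ℕ × Bool}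
    (hQ : ∀ q ∈ Q, (∀ i, (if (bd q i).2 then τ (bd q i).1 else σ (bd q i).1) =
        (if (bd q (i + 1)).2 then σ (bd q (i + 1)).1 else τ (bd q (i + 1)).1)) ∧
      (fun i => if (bd q i).2 then σ (bd q i).1 else τ (bd q i).1).Injective)
    (h2 : ∀ e ∈ E, (Q.filter fun q => ∃ i, (bd q i).1 = e).card = 2) (hC : Coh Q bd)
    (c : ℝ) {e : ℕ} (he : e ∈ E) :
    (∑ q ∈ Q, ∑ i : Fin 4, if (bd q i).1 = e then (if (bd q i).2 then c else -c) else 0) = 0 := by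
  -- the signed indicator of `e` in the boundary word of `q`
  set T : ℕ → ℝ := fun q => ∑ i : Fin 4,
    if (bd q i).1 = e then (if (bd q i).2 then c else -c) else 0 with hT
  have hTval : ∀ q ∈ Q, ∀ i, (bd q i).1 = e → T q = if (bd q i).2 then c else -c := by
    intro q hq i hi
    rw [hT]
    dsimp only
    rw [Finset.sum_eq_single i]
    · rw [if_pos hi]
    · intro j _ hj
      rw [if_neg]
      intro hj'
      exact hj (idx_unique (hQ q hq).1 (hQ q hq).2 (hj'.trans hi.symm))
    · intro hi'
      exact absurd (Finset.mem_univ i) hi'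
  have hT0 : ∀ q ∈ Q, T q ≠ 0 → ∃ i, (bd q i).1 = e := by
    intro q _ hq
    by_contra hne
    apply hq
    rw [hT]
    exact Finset.sum_eq_zero fun i _ => if_neg fun hi => hne ⟨i, hi⟩
  change ∑ q ∈ Q, T q = 0
  rw [← Finset.sum_filter_of_ne hT0]
  obtain ⟨q₁, q₂, hne, hpair⟩ := Finset.card_eq_two.1 (h2 e he)
  rw [hpair, Finset.sum_pair hne]
  have hq₁ : q₁ ∈ Q.filter fun q => ∃ i, (bd q i).1 = e := by rw [hpair]; simp
  have hq₂ : q₂ ∈ Q.filter fun q => ∃ i, (bd q i).1 = e := by rw [hpair]; simp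
  obtain ⟨hq₁Q, i₁, hi₁⟩ := Finset.mem_filter.1 hq₁
  obtain ⟨hq₂Q, i₂, hi₂⟩ := Finset.mem_filter.1 hq₂
  rw [hTval q₁ hq₁Q i₁ hi₁, hTval q₂ hq₂Q i₂ hi₂]
  have hflag := hC q₁ hq₁Q q₂ hq₂Q hne i₁ i₂ (hi₁.trans hi₂.symm)
  cases h₁ : (bd q₁ i₁).2 <;> cases h₂' : (bd q₂ i₂).2 <;> simp_all

/-- `d₁†` of a difference of cochains. -/
theorem cocurl_sub (Q : Finset ℕ) (bd : ℕ → Fin 4 → ℕ × Bool) (g g' : ℕ → ℝ) (e : ℕ) :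
    (∑ q ∈ Q, ∑ i : Fin 4,
        if (bd q i).1 = e then (if (bd q i).2 then g q - g' q else -(g q - g' q)) else 0) =
      (∑ q ∈ Q, ∑ i : Fin 4, if (bd q i).1 = e then (if (bd q i).2 then g q else -g q) else 0) -
        ∑ q ∈ Q, ∑ i : Fin 4,
          if (bd q i).1 = e then (if (bd q i).2 then g' q else -g' q) else 0 := by
  rw [← Finset.sum_sub_distrib]
  refine Finset.sum_congr rfl fun q _ => ?_
  rw [← Finset.sum_sub_distrib]
  refine Finset.sum_congr rfl fun i _ => ?_
  split_ifs <;> ring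

/-! ## Averaging over a second slot -/

/-- `d₀*` of the vertex-slot average is the average of the `d₀*`'s. -/
theorem dv0_avg (E V : Finset ℕ) (σ τ : ℕ → ℕ) (w : ℕ → ℕ → ℝ) (x : ℕ) :
    (∑ e ∈ E.filter (fun e => τ e = x), (∑ y ∈ V, w e y) / (V.card : ℝ)) -
        (∑ e ∈ E.filter (fun e => σ e = x), (∑ y ∈ V, w e y) / (V.card : ℝ)) =
      (∑ y ∈ V, ((∑ e ∈ E.filter (fun e => τ e = x), w e y) -
        (∑ e ∈ E.filter (fun e => σ e = x), w e y))) / (V.card : ℝ) := by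
  rw [Finset.sum_sub_distrib, sub_div, ← Finset.sum_div, ← Finset.sum_div,
    Finset.sum_comm (s := E.filter (fun e => τ e = x)) (t := V),
    Finset.sum_comm (s := E.filter (fun e => σ e = x)) (t := V)]

/-- `d₁` of the vertex-slot average is the average of the `d₁`'s. -/
theorem curl_avg (V : Finset ℕ) (bd : ℕ → Fin 4 → ℕ × Bool) (w : ℕ → ℕ → ℝ) (q : ℕ) :
    ∑ i : Fin 4, (if (bd q i).2 then (1 : ℝ) else -1) * ((∑ y ∈ V, w (bd q i).1 y) / (V.card : ℝ)) =
      (∑ y ∈ V, ∑ i : Fin 4, (if (bd q i).2 then (1 : ℝ) else -1) * w (bd q i).1 y) / (V.card : ℝ) := by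
  rw [Finset.sum_comm, Finset.sum_div]
  refine Finset.sum_congr rfl fun i _ => ?_
  rw [← Finset.mul_sum, mul_div_assoc]

/-! ## Mean and variance -/

/-- Subtracting the mean: `∑ (g − c)² = ∑ (g − m)² + n (m − c)²` with `m` the mean of `g`. -/
theorem sum_sq_sub_eq (s : Finset ℕ) (g : ℕ → ℝ) (c : ℝ) :
    ∑ i ∈ s, (g i - c) ^ 2 =
      (∑ i ∈ s, (g i - (∑ j ∈ s, g j) / s.card) ^ 2) +
        s.card * ((∑ j ∈ s, g j) / s.card - c) ^ 2 := by
  rcases s.eq_empty_or_nonempty with rfl | hs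
  · simp
  have hn : (s.card : ℝ) ≠ 0 := by exact_mod_cast hs.card_pos.ne'
  set S := ∑ j ∈ s, g j
  have h0 : ∑ i ∈ s, (g i - S / s.card) = 0 := by
    rw [Finset.sum_sub_distrib, Finset.sum_const, nsmul_eq_mul, mul_div_cancel₀ _ hn, sub_self]
  have hexp : ∀ i, (g i - c) ^ 2 =
      (g i - S / s.card) ^ 2 + 2 * (S / s.card - c) * (g i - S / s.card) +
        (S / s.card - c) ^ 2 := by
    intro i
    ring
  simp only [hexp, Finset.sum_add_distrib, ← Finset.mul_sum, h0, mul_zero, add_zero,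
    Finset.sum_const, nsmul_eq_mul]

/-- Jensen for the square: `n · (S / n)² ≤ ∑ g²` with `S = ∑ g`, `n` the cardinality. -/
theorem card_mul_sq_div_le (s : Finset ℕ) (g : ℕ → ℝ) :
    s.card * ((∑ i ∈ s, g i) / s.card) ^ 2 ≤ ∑ i ∈ s, g i ^ 2 := by
  rcases s.eq_empty_or_nonempty with rfl | hs
  · simp
  have hn : (0 : ℝ) < s.card := by exact_mod_cast hs.card_pos
  have hcs := sq_sum_le_card_mul_sum_sq (s := s) (f := g)
  rw [div_pow, ← mul_div_assoc, div_le_iff₀ (pow_pos hn 2)]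
  nlinarith [hcs]

/-- The mean-zero recentring has sum zero (also when the index set is empty). -/
theorem sum_sub_mean (s : Finset ℕ) (g : ℕ → ℝ) :
    ∑ i ∈ s, (g i - (∑ j ∈ s, g j) / s.card) = 0 := by
  rcases s.eq_empty_or_nonempty with rfl | hs
  · simp
  have hn : (s.card : ℝ) ≠ 0 := by exact_mod_cast hs.card_pos.ne'
  rw [Finset.sum_sub_distrib, Finset.sum_const, nsmul_eq_mul, mul_div_cancel₀ _ hn, sub_self]

end Summit.QuantumFields.YangMills.Cruxes.CurvatureAnchorR.WittenHessian.Kunneth
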